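import Literature.Analysis.FunctionSpaces.TorusLineAbsContinuity
import Literature.Analysis.Calculus.HardyClosedSet
import HarnessLib

/-!
# The directional Hardy inequality on the flat torus:
# `∫ ‖g‖² / ρₚ² ≤ 8 ‖∂ₚ g‖₂²` for `g` vanishing on an open set, `ρₚ` the distance to it along `𝐞ₚ`

Analysis/FunctionSpaces support file (everything proved; no definitions, no named facts; global
`volume` convention of `FlatTorus`). Let `g, h ∈ L¹(T^d; F)` with `ĥ(n) = 2πi nₚ ĝ(n)` (`h` is the
weak `p`-th derivative of `g`), and let `Z ⊆ T^d` be **open** with `g = 0` a.e. on `Z`. For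
`x ∈ T^d` let `ρ(x) = inf {|t| : x + t𝐞ₚ ∈ Z}` be the distance from `x` to `Z` **along the line
through `x` in the direction `𝐞ₚ`** (`𝐞ₚ t = Pi.single p (t : ℝ/ℤ)`), defined on the open set
`M = {x : the 𝐞ₚ-line through x meets Z}`. Then

  `∫⁻_{x ∈ M} ‖g(x)‖² / ρ(x)² dx ≤ 8 ∫⁻ ‖h‖²`     (`Torus.lintegral_enorm_sq_div_lineDist_sq_le`).

This is the Fubini assembly of (i) the absolutely continuous representative `g̃` of `g` on a.e.
line (`Torus.exists_lineAC_representative`, Evans–Gariepy §4.9.2 Thm. 2), (ii) the upgrade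
"`g̃ = 0` a.e. on the open line section of `Z` ⇒ `g̃ = 0` on its closure" (continuity), and (iii) the
one-dimensional Hardy inequality relative to a closed zero set
(`Literature.Analysis.Calculus.lintegral_enorm_sq_div_infDist_sq_le`, constant `8`, sharp one-sided
constant `4` of Hardy–Littlewood–Pólya Thm. 327) on one period of each line. It is the form in which
Hardy's inequality near the hard-core tubes `{|xᵢ - xⱼ| ≤ a}` enters the maximal-form bound for
hard-core Bose gases: a collar of a tube is covered by the regions where one coordinate line enters
the tube through a chord of length bounded below, along which `ρ` is comparable to the Euclidean
distance to the tube (geometry not done here).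

Auxiliary results of independent use: the shear inequality `∫⁻ Φ ≤ ∫⁻ₓ ∫⁻_{τ ∈ (0,1]} Φ(x + τ𝐞ₚ)`
valid for **every** `Φ : T^d → [0, ∞]` (`Torus.lintegral_le_lintegral_lintegral_line`, no
measurability, from Mathlib's `lintegral_map_le`, `lintegral_prod_le`) and its equality version for
a.e.-measurable `Φ`; null sets are null on a.e. line (`Torus.ae_ae_line_not_mem`); a continuous
function vanishing a.e. on an open subset of `ℝ` vanishes on its closure.

## Mathlib / tree search

Mathlib: `MeasureTheory.lintegral_map_le`, `lintegral_prod_le`, `Measure.prod_apply_symm`,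
`Measure.measure_ae_null_of_prod_null`, `Metric.infDist_image`, `Metric.infDist_closure`,
`UnitAddCircle.lintegral_preimage`; no Hardy inequality, no ACL. Tree: `TorusLineAbsContinuity`,
`TorusLineIntegrals`, `Literature/Analysis/Calculus/HardyClosedSet`.

## References

* V. Maz'ya, *Sobolev Spaces*, 2nd ed., Springer (2011), §2.3.3.
* L. C. Evans, R. F. Gariepy, *Measure Theory and Fine Properties of Functions* (1992), §4.9.2 Thm. 2.
  [EvansGariepy1992]
* G. H. Hardy, J. E. Littlewood, G. Pólya, *Inequalities* (1952), Thm. 327. [HardyLittlewoodPolya1952]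
-/

noncomputable section

open MeasureTheory Set Filter Function intervalIntegral UnitAddTorus Complex Metric
open scoped ENNReal NNReal Topology

namespace Literature.Analysis.FunctionSpaces

/-! ## A continuous function vanishing a.e. on an open set vanishes on its closure -/

/-- If `u : ℝ → E` is continuous, `S ⊆ ℝ` is open and `u = 0` a.e. on `S`, then `u = 0` on
`closure S` (a nonempty open set has positive Lebesgue measure). [folklore] -/
theorem eqOn_zero_closure_of_ae {E : Type*} [TopologicalSpace E] [T2Space E] [Zero E] {u : ℝ → E}
    (hu : Continuous u) {S : Set ℝ} (hS : IsOpen S) (h : ∀ᵐ t ∂(volume : Measure ℝ), t ∈ S → u t = 0) :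
    ∀ t ∈ closure S, u t = 0 := by
  have hS0 : ∀ t ∈ S, u t = 0 := by
    intro t ht
    by_contra hne
    have hopen : IsOpen (S ∩ {s | u s ≠ 0}) := hS.inter (isOpen_ne_fun hu continuous_const)
    have hpos : 0 < volume (S ∩ {s | u s ≠ 0}) := hopen.measure_pos volume ⟨t, ht, hne⟩
    have hnull : volume (S ∩ {s | u s ≠ 0}) = 0 := by
      have h' := ae_iff.1 h
      refine measure_mono_null (fun s hs => ?_) h'
      simp only [mem_setOf_eq, Classical.not_imp]
      exact ⟨hs.1, hs.2⟩
    exact hpos.ne' hnull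
  have hclosed : IsClosed {t | u t = 0} := isClosed_eq hu continuous_const
  exact fun t ht => (hclosed.closure_subset_iff.2 hS0) ht

namespace Torus

variable {d : Type*} [Fintype d] [DecidableEq d]

/-! ## Integration along lines: the shear inequality and null sets on lines -/

section Lines

/-- **Shear inequality**: for every `Φ : T^d → [0, ∞]` (no measurability) and every coordinate `p`,
`∫⁻ Φ ≤ ∫⁻ₓ ∫⁻_{τ ∈ (0,1]} Φ(x + τ𝐞ₚ) dτ dx` (the shear is measure preserving; Mathlib's
`lintegral_map_le` and `lintegral_prod_le` hold without measurability). [folklore] -/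
theorem lintegral_le_lintegral_lintegral_line (p : d) (Φ : UnitAddTorus d → ℝ≥0∞) :
    ∫⁻ x, Φ x ≤ ∫⁻ x : UnitAddTorus d, ∫⁻ τ in Ioc (0 : ℝ) 1, Φ (x + Pi.single p ((τ : ℝ) : UnitAddCircle)) := by
  have hΘ := measurePreserving_add_single_coe (d := d) p
  calc ∫⁻ x, Φ x = ∫⁻ x, Φ x ∂(Measure.map
        (fun z : UnitAddTorus d × ℝ => z.1 + Pi.single p ((z.2 : ℝ) : UnitAddCircle))
        ((volume : Measure (UnitAddTorus d)).prod (volume.restrict (Ioc (0 : ℝ) 1)))) := by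
        rw [hΘ.map_eq]
    _ ≤ ∫⁻ z, Φ (z.1 + Pi.single p ((z.2 : ℝ) : UnitAddCircle))
        ∂((volume : Measure (UnitAddTorus d)).prod (volume.restrict (Ioc (0 : ℝ) 1))) :=
        lintegral_map_le _ _
    _ ≤ ∫⁻ x : UnitAddTorus d, ∫⁻ τ in Ioc (0 : ℝ) 1, Φ (x + Pi.single p ((τ : ℝ) : UnitAddCircle)) :=
        lintegral_prod_le _

/-- **Shear identity** for a.e.-measurable `Φ : T^d → [0, ∞]`:
`∫⁻ₓ ∫⁻_{τ ∈ (0,1]} Φ(x + τ𝐞ₚ) dτ dx = ∫⁻ Φ`. [folklore] -/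
theorem lintegral_lintegral_line_Ioc_eq (p : d) {Φ : UnitAddTorus d → ℝ≥0∞} (hΦ : AEMeasurable Φ volume) :
    ∫⁻ x : UnitAddTorus d, ∫⁻ τ in Ioc (0 : ℝ) 1, Φ (x + Pi.single p ((τ : ℝ) : UnitAddCircle)) = ∫⁻ x, Φ x := by
  have hΘ := measurePreserving_add_single_coe (d := d) p
  have h1 : AEMeasurable Φ (Measure.map
      (fun z : UnitAddTorus d × ℝ => z.1 + Pi.single p ((z.2 : ℝ) : UnitAddCircle))
      ((volume : Measure (UnitAddTorus d)).prod (volume.restrict (Ioc (0 : ℝ) 1)))) := by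
    rwa [hΘ.map_eq]
  have h2 : AEMeasurable (fun z : UnitAddTorus d × ℝ => Φ (z.1 + Pi.single p ((z.2 : ℝ) : UnitAddCircle)))
      ((volume : Measure (UnitAddTorus d)).prod (volume.restrict (Ioc (0 : ℝ) 1))) :=
    hΦ.comp_quasiMeasurePreserving hΘ.quasiMeasurePreserving
  calc ∫⁻ x : UnitAddTorus d, ∫⁻ τ in Ioc (0 : ℝ) 1, Φ (x + Pi.single p ((τ : ℝ) : UnitAddCircle))
      = ∫⁻ z, Φ (z.1 + Pi.single p ((z.2 : ℝ) : UnitAddCircle))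
          ∂((volume : Measure (UnitAddTorus d)).prod (volume.restrict (Ioc (0 : ℝ) 1))) :=
        (lintegral_prod _ h2).symm
    _ = ∫⁻ x, Φ x ∂(Measure.map
          (fun z : UnitAddTorus d × ℝ => z.1 + Pi.single p ((z.2 : ℝ) : UnitAddCircle))
          ((volume : Measure (UnitAddTorus d)).prod (volume.restrict (Ioc (0 : ℝ) 1)))) :=
        (lintegral_map' h1 hΘ.measurable.aemeasurable).symm
    _ = ∫⁻ x, Φ x := by rw [hΘ.map_eq]

omit [Fintype d] in
/-- One period is as good as another: `∫⁻_{(t₀, t₀+1]} G(x + τ𝐞ₚ) dτ = ∫⁻_{(0,1]} G(x + τ𝐞ₚ) dτ`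
(both are the Haar integral over the circle, `UnitAddCircle.lintegral_preimage`). [folklore] -/
theorem lintegral_Ioc_line_eq (p : d) (G : UnitAddTorus d → ℝ≥0∞) (x : UnitAddTorus d) (t₀ : ℝ) :
    ∫⁻ τ in Ioc t₀ (t₀ + 1), G (x + Pi.single p ((τ : ℝ) : UnitAddCircle)) =
      ∫⁻ τ in Ioc (0 : ℝ) 1, G (x + Pi.single p ((τ : ℝ) : UnitAddCircle)) := by
  have h1 := UnitAddCircle.lintegral_preimage t₀ (fun b => G (x + Pi.single p b))
  have h2 := UnitAddCircle.lintegral_preimage 0 (fun b => G (x + Pi.single p b))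
  rw [zero_add] at h2
  rw [h1, h2]

/-- **Null sets are null on a.e. line**: if `B ⊆ T^d` is null then for a.e. `x` the set of real
`t` with `x + t𝐞ₚ ∈ B` is Lebesgue-null (Tonelli for `{(x, t) : x + t𝐞ₚ ∈ B}` computed through
its `t`-sections, each a translate of `B`). [folklore] -/
theorem ae_ae_line_not_mem (p : d) {B : Set (UnitAddTorus d)} (hB : volume B = 0) :
    ∀ᵐ x ∂(volume : Measure (UnitAddTorus d)), ∀ᵐ t ∂(volume : Measure ℝ),
      x + Pi.single p ((t : ℝ) : UnitAddCircle) ∉ B := by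
  set B' := toMeasurable volume B with hB'_def
  have hB' : volume B' = 0 := by rw [hB'_def, measure_toMeasurable]; exact hB
  have hmeas : Measurable fun z : UnitAddTorus d × ℝ => z.1 + Pi.single p ((z.2 : ℝ) : UnitAddCircle) :=
    (measurePreserving_add_single_coe (d := d) p).measurable
  set S : Set (UnitAddTorus d × ℝ) :=
    (fun z : UnitAddTorus d × ℝ => z.1 + Pi.single p ((z.2 : ℝ) : UnitAddCircle)) ⁻¹' B' with hS_def
  have hSm : MeasurableSet S := hmeas (measurableSet_toMeasurable _ _)
  have hS0 : ((volume : Measure (UnitAddTorus d)).prod (volume : Measure ℝ)) S = 0 := by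
    rw [Measure.prod_apply_symm hSm]
    have h : ∀ t : ℝ, (volume : Measure (UnitAddTorus d)) ((fun x => (x, t)) ⁻¹' S) = 0 := by
      intro t
      have hpre : (fun x : UnitAddTorus d => (x, t)) ⁻¹' S =
          (fun x : UnitAddTorus d => x + Pi.single p ((t : ℝ) : UnitAddCircle)) ⁻¹' B' := rfl
      rw [hpre, (measurePreserving_add_single p ((t : ℝ) : UnitAddCircle)).measure_preimage
        (measurableSet_toMeasurable _ _).nullMeasurableSet, hB']
    simp only [h, lintegral_zero]
  have hae := Measure.measure_ae_null_of_prod_null hS0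
  filter_upwards [hae] with x hx
  have hx' : (volume : Measure ℝ) {t | x + Pi.single p ((t : ℝ) : UnitAddCircle) ∈ B'} = 0 := by
    rw [Pi.zero_apply] at hx
    exact hx
  have h2 : ∀ᵐ t ∂(volume : Measure ℝ), x + Pi.single p ((t : ℝ) : UnitAddCircle) ∉ B' :=
    measure_eq_zero_iff_ae_notMem.1 hx'
  filter_upwards [h2] with t ht
  exact fun h => ht (subset_toMeasurable _ _ h)

omit [Fintype d] in
/-- The line through `x + t𝐞ₚ` is the line through `x`, reparametrised: the directional distance
`inf {|s| : x + t𝐞ₚ + s𝐞ₚ ∈ Z}` equals `dist(t, closure {s : x + s𝐞ₚ ∈ Z})`. [folklore] -/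
theorem infDist_zero_line_eq (p : d) (Z : Set (UnitAddTorus d)) (x : UnitAddTorus d) (t : ℝ) :
    infDist (0 : ℝ) {s : ℝ | x + Pi.single p ((t : ℝ) : UnitAddCircle) + Pi.single p ((s : ℝ) : UnitAddCircle) ∈ Z} =
      infDist t (closure {s : ℝ | x + Pi.single p ((s : ℝ) : UnitAddCircle) ∈ Z}) := by
  have hΦ : Isometry fun s : ℝ => s - t := Isometry.of_dist_eq fun a b => by
    simp only [Real.dist_eq, sub_sub_sub_cancel_right]
  have hset : {s : ℝ | x + Pi.single p ((t : ℝ) : UnitAddCircle) + Pi.single p ((s : ℝ) : UnitAddCircle) ∈ Z} =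
      (fun s : ℝ => s - t) '' {s : ℝ | x + Pi.single p ((s : ℝ) : UnitAddCircle) ∈ Z} := by
    ext s
    simp only [mem_setOf_eq, mem_image, add_single_add_single]
    constructor
    · intro h
      exact ⟨s + t, h, add_sub_cancel_right s t⟩
    · rintro ⟨r, hr, rfl⟩
      rwa [sub_add_cancel]
  have himg := infDist_image (x := t) (t := {s : ℝ | x + Pi.single p ((s : ℝ) : UnitAddCircle) ∈ Z}) hΦ
  rw [sub_self] at himg
  rw [hset, infDist_closure]
  exact himg

end Lines

/-! ## The directional Hardy inequality -/

section Hardy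

variable {F : Type*} [NormedAddCommGroup F] [NormedSpace ℂ F] [CompleteSpace F]

omit [Fintype d] [CompleteSpace F] in
/-- **One line.** Let `h_x = h(x + ·𝐞ₚ)` be integrable on bounded intervals, `u(t) = g'(x + t𝐞ₚ)` with
`u(t) = u(0) + ∫₀ᵗ h_x` for all `t`, and `u = 0` a.e. on the open line section
`S = {t : x + t𝐞ₚ ∈ Z}` of the open set `Z`. Then, with `M = {y : ∃ t, y + t𝐞ₚ ∈ Z}` and
`ρ(y) = inf{|t| : y + t𝐞ₚ ∈ Z}`,
`∫⁻_{τ ∈ (0,1]} 𝟙_M(x + τ𝐞ₚ) ‖g'(x + τ𝐞ₚ)‖²/ρ(x + τ𝐞ₚ)² dτ ≤ 8 ∫⁻_{(0,1]} ‖h_x‖²`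
(one period of the closed-set Hardy inequality `lintegral_enorm_sq_div_infDist_sq_le` for the
`1`-periodic zero set `closure S`, or `0 ≤ …` if the line misses `Z`). [folklore] -/
theorem lintegral_line_indicator_div_lineDist_sq_le (p : d) {Z : Set (UnitAddTorus d)} (hZ : IsOpen Z)
    {g' h : UnitAddTorus d → F} {x : UnitAddTorus d}
    (hhx : ∀ a b : ℝ, IntervalIntegrable (fun τ : ℝ => h (x + Pi.single p ((τ : ℝ) : UnitAddCircle))) volume a b)
    (hgx : ∀ t : ℝ, g' (x + Pi.single p ((t : ℝ) : UnitAddCircle)) =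
      g' x + ∫ τ in (0 : ℝ)..t, h (x + Pi.single p ((τ : ℝ) : UnitAddCircle)))
    (hZx : ∀ᵐ t ∂(volume : Measure ℝ), x + Pi.single p ((t : ℝ) : UnitAddCircle) ∈ Z →
      g' (x + Pi.single p ((t : ℝ) : UnitAddCircle)) = 0) :
    ∫⁻ τ in Ioc (0 : ℝ) 1, {y : UnitAddTorus d | ∃ t : ℝ, y + Pi.single p ((t : ℝ) : UnitAddCircle) ∈ Z}.indicator
        (fun y => ‖g' y‖ₑ ^ 2 / ENNReal.ofReal
          (infDist (0 : ℝ) {t : ℝ | y + Pi.single p ((t : ℝ) : UnitAddCircle) ∈ Z} ^ 2))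
        (x + Pi.single p ((τ : ℝ) : UnitAddCircle)) ≤
      8 * ∫⁻ τ in Ioc (0 : ℝ) 1, ‖h (x + Pi.single p ((τ : ℝ) : UnitAddCircle))‖ₑ ^ 2 := by
  set S : Set ℝ := {t : ℝ | x + Pi.single p ((t : ℝ) : UnitAddCircle) ∈ Z} with hS_def
  set M : Set (UnitAddTorus d) := {y | ∃ t : ℝ, y + Pi.single p ((t : ℝ) : UnitAddCircle) ∈ Z} with hM_def
  set u : ℝ → F := fun t => g' (x + Pi.single p ((t : ℝ) : UnitAddCircle)) with hu_def
  set G : UnitAddTorus d → ℝ≥0∞ := M.indicator (fun y : UnitAddTorus d => ‖g' y‖ₑ ^ 2 / ENNReal.ofReal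
      (infDist (0 : ℝ) {t : ℝ | y + Pi.single p ((t : ℝ) : UnitAddCircle) ∈ Z} ^ 2)) with hG_def
  -- the line map is continuous and `1`-periodic
  have hcont : Continuous fun t : ℝ => x + Pi.single p ((t : ℝ) : UnitAddCircle) :=
    continuous_const.add ((continuous_single p).comp continuous_quotient_mk')
  have hper : Periodic (fun t : ℝ => x + Pi.single p ((t : ℝ) : UnitAddCircle) ∈ Z) 1 :=
    periodic_comp_add_single (fun y => y ∈ Z) p x
  have hS : IsOpen S := hZ.preimage hcont
  -- `u` is continuous and vanishes on `closure S`
  have hu_cont : Continuous u := by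
    have : u = fun t => g' x + ∫ τ in (0 : ℝ)..t, h (x + Pi.single p ((τ : ℝ) : UnitAddCircle)) :=
      funext fun t => hgx t
    rw [this]
    exact continuous_const.add (intervalIntegral.continuous_primitive hhx 0)
  have hu0 : ∀ t ∈ closure S, u t = 0 := eqOn_zero_closure_of_ae hu_cont hS hZx
  -- the integrand along the line
  have hpt : ∀ τ : ℝ, G (x + Pi.single p ((τ : ℝ) : UnitAddCircle)) ≤
      ‖u τ‖ₑ ^ 2 / ENNReal.ofReal (infDist τ (closure S) ^ 2) := by
    intro τ
    by_cases hτ : x + Pi.single p ((τ : ℝ) : UnitAddCircle) ∈ M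
    · rw [hG_def, indicator_of_mem hτ, infDist_zero_line_eq]
    · rw [hG_def, indicator_of_notMem hτ]
      exact zero_le
  by_cases hSe : S = ∅
  · -- the line misses `Z`: the indicator vanishes along it
    have h0 : ∀ τ : ℝ, x + Pi.single p ((τ : ℝ) : UnitAddCircle) ∉ M := by
      rintro τ ⟨t, ht⟩
      rw [add_single_add_single] at ht
      have : t + τ ∈ S := ht
      rw [hSe] at this
      exact Set.notMem_empty _ this
    calc ∫⁻ τ in Ioc (0 : ℝ) 1, G (x + Pi.single p ((τ : ℝ) : UnitAddCircle))
        = ∫⁻ τ in Ioc (0 : ℝ) 1, (0 : ℝ≥0∞) :=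
          setLIntegral_congr_fun measurableSet_Ioc fun τ _ => by
            rw [hG_def]; exact indicator_of_notMem (h0 τ) _
      _ ≤ _ := by rw [lintegral_zero]; exact zero_le
  · -- the line meets `Z`: closed-set Hardy on one period
    obtain ⟨s₀, hs₀⟩ := nonempty_iff_ne_empty.2 hSe
    set K : Set ℝ := closure S with hK_def
    have hK : IsClosed K := isClosed_closure
    have hSK : S ⊆ K := subset_closure
    have hmemS : ∀ k : ℤ, s₀ - k * 1 ∈ S := fun k => by
      have := hper.sub_int_mul_eq k (x := s₀)
      simp only [hS_def, mem_setOf_eq]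
      rw [this]
      exact hs₀
    have hne₁ : ∀ t : ℝ, (K ∩ Iic t).Nonempty := fun t => by
      obtain ⟨k, hk⟩ := exists_int_ge (s₀ - t)
      refine ⟨s₀ - k * 1, hSK (hmemS k), ?_⟩
      show s₀ - (k : ℝ) * 1 ≤ t
      linarith
    have hne₂ : ∀ t : ℝ, (K ∩ Ici t).Nonempty := fun t => by
      obtain ⟨k, hk⟩ := exists_int_ge (t - s₀)
      refine ⟨s₀ - ((-k : ℤ) : ℝ) * 1, hSK (hmemS (-k)), ?_⟩
      show t ≤ s₀ - ((-k : ℤ) : ℝ) * 1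
      push_cast
      linarith
    have ht₀ : s₀ ∈ K := hSK hs₀
    have ht₁ : s₀ + 1 ∈ K := by
      have := hmemS (-1)
      simp only [Int.cast_neg, Int.cast_one, neg_mul, one_mul, sub_neg_eq_add] at this
      exact hSK this
    -- hypotheses of the one-dimensional inequality on the window `(s₀, s₀ + 1)`
    have hum : AEStronglyMeasurable u (volume.restrict (Ioo s₀ (s₀ + 1))) :=
      hu_cont.aestronglyMeasurable.restrict
    have hhm : AEStronglyMeasurable (fun τ : ℝ => h (x + Pi.single p ((τ : ℝ) : UnitAddCircle)))
        (volume.restrict (Ioo s₀ (s₀ + 1))) :=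
      ((hhx s₀ (s₀ + 1)).1.mono_set Ioo_subset_Ioc_self).aestronglyMeasurable
    have hu2 : ∀ s ∈ Icc s₀ (s₀ + 1), ∀ t ∈ Icc s₀ (s₀ + 1),
        u t - u s = ∫ σ in s..t, h (x + Pi.single p ((σ : ℝ) : UnitAddCircle)) := by
      intro s _ t _
      simp only [hu_def, hgx t, hgx s, add_sub_add_left_eq_sub]
      exact intervalIntegral.integral_interval_sub_left (hhx 0 t) (hhx 0 s)
    have hK0 : ∀ t ∈ K ∩ Icc s₀ (s₀ + 1), u t = 0 := fun t ht => hu0 t ht.1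
    have key := Literature.Analysis.Calculus.lintegral_enorm_sq_div_infDist_sq_le hK hne₁ hne₂ ht₀ ht₁
      hum hhm hu2 hK0
    -- move both sides to the period `(0, 1]`
    calc ∫⁻ τ in Ioc (0 : ℝ) 1, G (x + Pi.single p ((τ : ℝ) : UnitAddCircle))
        = ∫⁻ τ in Ioc s₀ (s₀ + 1), G (x + Pi.single p ((τ : ℝ) : UnitAddCircle)) :=
          (lintegral_Ioc_line_eq p G x s₀).symm
      _ = ∫⁻ τ in Ioo s₀ (s₀ + 1), G (x + Pi.single p ((τ : ℝ) : UnitAddCircle)) := by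
          rw [restrict_Ioo_eq_restrict_Ioc]
      _ ≤ ∫⁻ τ in Ioo s₀ (s₀ + 1), ‖u τ‖ₑ ^ 2 / ENNReal.ofReal (infDist τ K ^ 2) :=
          lintegral_mono fun τ => hpt τ
      _ ≤ 8 * ∫⁻ τ in Ioo s₀ (s₀ + 1), ‖h (x + Pi.single p ((τ : ℝ) : UnitAddCircle))‖ₑ ^ 2 := key
      _ = 8 * ∫⁻ τ in Ioc (0 : ℝ) 1, ‖h (x + Pi.single p ((τ : ℝ) : UnitAddCircle))‖ₑ ^ 2 := by
          rw [restrict_Ioo_eq_restrict_Ioc, lintegral_Ioc_line_eq p (fun y => ‖h y‖ₑ ^ 2) x s₀]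

/-- **The directional Hardy inequality on the flat torus.** Let `g, h ∈ L¹(T^d; F)` (`F` a complex
Banach space) with `ĥ(n) = 2πi nₚ ĝ(n)` for all `n ∈ ℤ^d`, and let `Z ⊆ T^d` be open with `g = 0`
a.e. on `Z`. With `M = {x : ∃ t, x + t𝐞ₚ ∈ Z}` (the lines meeting `Z`) and the directional distance
`ρ(x) = inf {|t| : x + t𝐞ₚ ∈ Z}`,

  `∫⁻_{x ∈ M} ‖g(x)‖² / ρ(x)² dx ≤ 8 ∫⁻ ‖h‖²`

(in `[0, ∞]`; `0/0 = 0` on `Z`). For `g` in the spectral `H¹` this is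
`≤ 8 · 4π² ∑ₙ nₚ² ‖ĝ(n)‖²` (`Torus.exists_lineDeriv_of_tsum_ne_top`). Maz'ya, *Sobolev Spaces*,
§2.3.3 (Hardy inequality with the distance to the zero set), one direction at a time on the torus.
[folklore] -/
theorem lintegral_enorm_sq_div_lineDist_sq_le (p : d) {g h : UnitAddTorus d → F} (hg : Integrable g volume)
    (hh : Integrable h volume)
    (hcoeff : ∀ n : d → ℤ, mFourierCoeff h n = (2 * Real.pi * I * (n p)) • mFourierCoeff g n)
    {Z : Set (UnitAddTorus d)} (hZ : IsOpen Z) (hgZ : ∀ᵐ x ∂(volume : Measure (UnitAddTorus d)), x ∈ Z → g x = 0) :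
    ∫⁻ x in {y : UnitAddTorus d | ∃ t : ℝ, y + Pi.single p ((t : ℝ) : UnitAddCircle) ∈ Z},
        ‖g x‖ₑ ^ 2 / ENNReal.ofReal (infDist (0 : ℝ) {t : ℝ | x + Pi.single p ((t : ℝ) : UnitAddCircle) ∈ Z} ^ 2) ≤
      8 * ∫⁻ x, ‖h x‖ₑ ^ 2 := by
  obtain ⟨g', hg'g, -, hline⟩ := exists_lineAC_representative p hg hh hcoeff
  set M : Set (UnitAddTorus d) := {y | ∃ t : ℝ, y + Pi.single p ((t : ℝ) : UnitAddCircle) ∈ Z} with hM_def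
  set Ψ : UnitAddTorus d → ℝ≥0∞ := M.indicator (fun y : UnitAddTorus d => ‖g' y‖ₑ ^ 2 / ENNReal.ofReal
      (infDist (0 : ℝ) {t : ℝ | y + Pi.single p ((t : ℝ) : UnitAddCircle) ∈ Z} ^ 2)) with hΨ_def
  -- `M` is open
  have hM : MeasurableSet M := by
    have : M = ⋃ t : ℝ, (fun y : UnitAddTorus d => y + Pi.single p ((t : ℝ) : UnitAddCircle)) ⁻¹' Z := by
      ext y; simp only [hM_def, mem_setOf_eq, mem_iUnion, mem_preimage]
    rw [this]
    exact (isOpen_iUnion fun t => hZ.preimage (continuous_id.add continuous_const)).measurableSet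
  -- Step 0: pass to the representative and to an indicator
  have hLHS : ∫⁻ x in M, ‖g x‖ₑ ^ 2 / ENNReal.ofReal
      (infDist (0 : ℝ) {t : ℝ | x + Pi.single p ((t : ℝ) : UnitAddCircle) ∈ Z} ^ 2) = ∫⁻ x, Ψ x := by
    rw [hΨ_def, lintegral_indicator hM]
    refine lintegral_congr_ae (ae_restrict_of_ae ?_)
    filter_upwards [hg'g] with x hx
    rw [hx]
  -- Step 1: `g'` vanishes a.e. on `Z`, hence a.e. on a.e. line section of `Z`
  have hB : volume {y : UnitAddTorus d | y ∈ Z ∧ g' y ≠ 0} = 0 := by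
    have h1 : ∀ᵐ y ∂(volume : Measure (UnitAddTorus d)), y ∈ Z → g' y = 0 := by
      filter_upwards [hgZ, hg'g] with y hy hy'
      rw [hy']; exact hy
    have h2 := ae_iff.1 h1
    refine measure_mono_null (fun y hy => ?_) h2
    simp only [mem_setOf_eq, Classical.not_imp]
    exact hy
  have hlineZ := ae_ae_line_not_mem p hB
  -- Step 2: the bound on a.e. line
  have hper : ∀ᵐ x ∂(volume : Measure (UnitAddTorus d)),
      ∫⁻ τ in Ioc (0 : ℝ) 1, Ψ (x + Pi.single p ((τ : ℝ) : UnitAddCircle)) ≤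
        8 * ∫⁻ τ in Ioc (0 : ℝ) 1, ‖h (x + Pi.single p ((τ : ℝ) : UnitAddCircle))‖ₑ ^ 2 := by
    filter_upwards [hline, hlineZ] with x hx hxZ
    have hxZ' : ∀ᵐ t ∂(volume : Measure ℝ), x + Pi.single p ((t : ℝ) : UnitAddCircle) ∈ Z →
        g' (x + Pi.single p ((t : ℝ) : UnitAddCircle)) = 0 := by
      filter_upwards [hxZ] with t ht
      intro htZ
      by_contra hne
      exact ht ⟨htZ, hne⟩
    exact lintegral_line_indicator_div_lineDist_sq_le p hZ hx.1 hx.2 hxZ'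
  -- Step 3: integrate over the lines (`calc` is avoided: its `Trans` elaboration times out here)
  rw [hLHS]
  refine (lintegral_le_lintegral_lintegral_line p Ψ).trans ?_
  refine (lintegral_mono_ae hper).trans (le_of_eq ?_)
  rw [lintegral_const_mul' _ _ (by norm_num),
    lintegral_lintegral_line_Ioc_eq p (hh.aestronglyMeasurable.enorm.pow_const 2)]

end Hardy

end Torus

end Literature.Analysis.FunctionSpaces

end
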